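import Literature.Barriers.BirchSwinnertonDyer.RankNotSumOfLocalInvariantsF5NormDescentProofs
import Literature.Barriers.BirchSwinnertonDyer.RankNotSumOfLocalInvariantsF3NormDescentK13Proofs
import Literature.NumberTheory.NumberFields.CyclicQuinticField11Descent
import HarnessLib

/-!
# Barrier (BirchSwinnertonDyer), rank mod `5`: the conductor-`11` descent, and what remains

Continuation of `RankNotSumOfLocalInvariantsF5NormDescentProofs.lean` towards the named fact
`Literature.Barriers.BirchSwinnertonDyer.DokchitserDokchitser2011_rank_480a1_F5` (`rk E(F₅) = 1` for
`E = 480a1` over the degree-`25` field `F₅ ⊂ ℚ(ζ₁₁, ζ₂₄₁) = ℚ(ζ₂₆₅₁)` of T. Dokchitser–V. Dokchitser,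
*A note on the Mordell–Weil rank modulo `n`*, J. Number Theory 131 (2011), proof of Thm. 2: "2-descent
shows that `rk E/F₅ = 1` (e.g. using Magma, over all minimal non-trivial subfields of `F_n`)"). That
file reduced the fact to six norm-`1` descent statements, one for each quintic subfield
`F₅^{⟨σ⟩}`, `σ ≠ 1`. Here the FIRST of the six is discharged — over the subfield `ℚ(ζ₁₁)⁺`, of
conductor `11` — by the explicit `2`-descent of
`Literature/NumberTheory/NumberFields/CyclicQuinticField11Descent.lean`
(`Literature.NumberTheory.NumberFields.CyclicQuintic11.normDescent_of_root`):

* `DokchitserDokchitser2011.θ11 K = ζ₁₁ + ζ₁₁⁻¹` (`ζ₁₁ = ζ₂₆₅₁²⁴¹`), a root of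
  `X⁵ + X⁴ - 4X³ - 3X² + 3X + 1` (`θ11_rel`: `z⁵ f(z + z⁻¹) = 1 + z + ⋯ + z¹⁰`), lying in `F₅`
  (`θ11_mem_F5`: a fifth power `a⁵ ∈ (ℤ/2651)ˣ` is `≡ ±1 (mod 11)`, so it sends `ζ₁₁ ↦ ζ₁₁^{±1}`);
* `F5.normDescent_fixedField_of_apply_θ11F_eq`: the norm-`1` descent statement holds over
  `F₅^{⟨σ⟩}` for every `σ ≠ 1` FIXING `θ11` (then `F₅^{⟨σ⟩} ∋ θ11` is a quintic field containing a
  root of `f`, i.e. a copy of `ℚ(ζ₁₁)⁺`);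
* `DokchitserDokchitser2011_mordellWeilRank_480a1_F5_of_normDescent_off11`,
  `DokchitserDokchitser2011_rank_480a1_F5_of_normDescent_off11`: CONSEQUENTLY the rank leaf and the
  named fact follow from the norm-`1` descent statements for the `σ ≠ 1` that MOVE `θ11`, i.e. over
  the five remaining quintic subfields (conductor `241` and four of conductor `2651`), which remain
  as hypotheses (no named fact is introduced).

## References

* T. Dokchitser, V. Dokchitser, *A note on the Mordell–Weil rank modulo `n`*, J. Number Theory 131
  (2011) 1833–1839, arXiv:0910.4588: proof of Thm. 2. [DokchitserDokchitser2011RankModN]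
* J. H. Silverman, *The Arithmetic of Elliptic Curves*, 2nd ed., GTM 106 (2009): Prop. X.1.4
  (complete `2`-descent). [SilvermanAEC2009]
* L. C. Washington, *Introduction to Cyclotomic Fields*, GTM 83: §2 (the maximal real subfield
  `ℚ(ζ_p)⁺ = ℚ(ζ_p + ζ_p⁻¹)`). [folklore]
-/

noncomputable section

open scoped NumberField

open NumberField WeierstrassCurve IntermediateField

namespace Literature.Barriers.BirchSwinnertonDyer

namespace DokchitserDokchitser2011

variable (K : Type) [Field K] [NumberField K] [IsCyclotomicExtension {2651} ℚ K]

/-! ### The Gaussian period `θ11 = ζ₁₁ + ζ₁₁⁻¹` -/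

/-- `ζ₁₁ := ζ₂₆₅₁²⁴¹`, a primitive `11`-th root of unity in `K` (`2651 = 241 · 11`). [folklore] -/
def ζ11 : K := IsCyclotomicExtension.zeta 2651 ℚ K ^ 241

/-- `ζ₁₁` is a primitive `11`-th root of unity. [folklore] -/
theorem isPrimitiveRoot_ζ11 : IsPrimitiveRoot (ζ11 K) 11 :=
  (IsCyclotomicExtension.zeta_spec 2651 ℚ K).pow (by norm_num) (by norm_num)

/-- `ζ₁₁¹¹ = 1`. [folklore] -/
theorem ζ11_pow_eleven : ζ11 K ^ 11 = 1 := (isPrimitiveRoot_ζ11 K).pow_eq_one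

/-- `ζ₁₁ ≠ 0`. [folklore] -/
theorem ζ11_ne_zero : ζ11 K ≠ 0 := (isPrimitiveRoot_ζ11 K).ne_zero (by norm_num)

/-- **The Gaussian period `θ11 = ζ₁₁ + ζ₁₁⁻¹`** (`= 2cos(2π/11)` under the standard embedding), a
generator of the conductor-`11` quintic subfield `ℚ(ζ₁₁)⁺` of `F₅`. [folklore] -/
def θ11 : K := ζ11 K + (ζ11 K)⁻¹

/-- **`θ11` is a root of `f = X⁵ + X⁴ - 4X³ - 3X² + 3X + 1`**: for `z = ζ₁₁`,
`z⁵ f(z + z⁻¹) = 1 + z + z² + ⋯ + z¹⁰ = 0`. [folklore] -/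
theorem θ11_rel : θ11 K ^ 5 + θ11 K ^ 4 - 4 * θ11 K ^ 3 - 3 * θ11 K ^ 2 + 3 * θ11 K + 1 = 0 := by
  set z := ζ11 K with hz
  have hz0 : z ≠ 0 := ζ11_ne_zero K
  have hsum : ∑ i ∈ Finset.range 11, z ^ i = 0 :=
    (isPrimitiveRoot_ζ11 K).geom_sum_eq_zero (by norm_num)
  have key : z ^ 5 * (θ11 K ^ 5 + θ11 K ^ 4 - 4 * θ11 K ^ 3 - 3 * θ11 K ^ 2 + 3 * θ11 K + 1) =
      ∑ i ∈ Finset.range 11, z ^ i := by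
    simp only [Finset.sum_range_succ, Finset.sum_range_zero, θ11, ← hz]
    field_simp
    ring
  rw [hsum] at key
  rcases mul_eq_zero.mp key with h | h
  · exact absurd h (pow_ne_zero 5 hz0)
  · exact h

/-- **A fifth power in `(ℤ/2651)ˣ` acts on `ζ₁₁` as `ζ₁₁ ↦ ζ₁₁^{±1}`**: for `c` prime to `11`,
`c⁵ ≡ ±1 (mod 11)` (`c¹⁰ ≡ 1`), so `ζ₁₁^{c⁵} ∈ {ζ₁₁, ζ₁₁⁻¹}`. [folklore] -/
theorem ζ11_pow_pow_five {c : ℕ} (hc : Nat.Coprime c 11) :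
    ζ11 K ^ c ^ 5 = ζ11 K ∨ ζ11 K ^ c ^ 5 = (ζ11 K)⁻¹ := by
  have hneg : (-1 : ZMod 11) = ((10 : ℕ) : ZMod 11) := by decide
  haveI : Fact (Nat.Prime 11) := ⟨by norm_num⟩
  set z := ζ11 K with hz
  have h11 : z ^ 11 = 1 := ζ11_pow_eleven K
  have hmod : ∀ m : ℕ, z ^ m = z ^ (m % 11) := fun m => by
    conv_lhs => rw [← Nat.mod_add_div m 11, pow_add, pow_mul, h11, one_pow, mul_one]
  have hc0 : (c : ZMod 11) ≠ 0 := by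
    rw [Ne, ZMod.natCast_eq_zero_iff]
    intro h
    have h11 : Nat.Coprime 11 11 := Nat.Coprime.coprime_dvd_left h hc
    norm_num at h11
  have h10 : (c : ZMod 11) ^ 10 = 1 := by
    have := ZMod.pow_card_sub_one_eq_one hc0
    simpa using this
  have hsq : (c : ZMod 11) ^ 5 * (c : ZMod 11) ^ 5 = 1 := by rw [← pow_add]; exact h10
  rcases mul_self_eq_one_iff.mp hsq with h1 | h1
  · left
    have hm : c ^ 5 % 11 = 1 := by
      have h' : ((c ^ 5 : ℕ) : ZMod 11) = ((1 : ℕ) : ZMod 11) := by push_cast; exact h1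
      rw [ZMod.natCast_eq_natCast_iff'] at h'
      simpa using h'
    rw [hmod, hm, pow_one]
  · right
    have hm : c ^ 5 % 11 = 10 := by
      have h' : ((c ^ 5 : ℕ) : ZMod 11) = ((10 : ℕ) : ZMod 11) := by
        rw [← hneg]; push_cast; exact h1
      rw [ZMod.natCast_eq_natCast_iff'] at h'
      simpa using h'
    rw [hmod, hm]
    refine eq_inv_of_mul_eq_one_left ?_
    rw [← pow_succ, h11]

set_option backward.isDefEq.respectTransparency false in
/-- **`θ11 ∈ F₅`**: an element `g` of the subgroup of fifth powers of `Gal(K/ℚ) ≅ (ℤ/2651)ˣ` acts on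
`ζ₁₁ = ζ²⁴¹` by `ζ₁₁ ↦ ζ₁₁^{a⁵} = ζ₁₁^{±1}` (`IsCyclotomicExtension.Rat.galEquivZMod_apply_of_pow_eq`,
`ζ11_pow_pow_five`), hence fixes `ζ₁₁ + ζ₁₁⁻¹`. [folklore] -/
theorem θ11_mem_F5 : θ11 K ∈ F5 K := by
  rw [F5, IntermediateField.mem_fixedField_iff]
  intro g hg
  rw [galFifthPowers, Subgroup.mem_comap, MonoidHom.mem_range] at hg
  obtain ⟨b, hb⟩ := hg
  rw [powMonoidHom_apply] at hb
  have hw : ζ11 K ^ 2651 = 1 := by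
    rw [show 2651 = 11 * 241 by norm_num, pow_mul, ζ11_pow_eleven, one_pow]
  have hgw := IsCyclotomicExtension.Rat.galEquivZMod_apply_of_pow_eq 2651 K g hw
  -- the exponent is `(b⁵).val ≡ c⁵ (mod 2651)`, `c = b.val`
  set c : ℕ := ((b : (ZMod 2651)ˣ) : ZMod 2651).val with hc
  have hval : ((IsCyclotomicExtension.Rat.galEquivZMod 2651 K) g).val.val = c ^ 5 % 2651 := by
    have e : ((IsCyclotomicExtension.Rat.galEquivZMod 2651 K) g : (ZMod 2651)ˣ) = b ^ 5 := by
      rw [hb]; rfl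
    rw [e, Units.val_pow_eq_pow_val, ← ZMod.natCast_zmod_val ((b : (ZMod 2651)ˣ) : ZMod 2651),
      ← hc, ← Nat.cast_pow, ZMod.val_natCast]
  have hcop : Nat.Coprime c 11 :=
    (ZMod.val_coe_unit_coprime b).coprime_dvd_right (by norm_num)
  have hmod : ∀ m : ℕ, ζ11 K ^ m = ζ11 K ^ (m % 2651) := fun m => by
    conv_lhs => rw [← Nat.mod_add_div m 2651, pow_add, pow_mul, hw, one_pow, mul_one]
  have hgz : g (ζ11 K) = ζ11 K ^ c ^ 5 := by rw [hgw, hval, ← hmod]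
  change g (θ11 K) = θ11 K
  rw [θ11, map_add, map_inv₀, hgz]
  rcases ζ11_pow_pow_five K hcop with h | h
  · rw [h]
  · rw [h, inv_inv, add_comm]

/-- **`θ11` as an element of `F₅`.** [folklore] -/
def θ11F : F5 K := ⟨θ11 K, θ11_mem_F5 K⟩

/-- `θ11F` is a root of `f` (in `F₅`). [folklore] -/
theorem θ11F_rel : θ11F K ^ 5 + θ11F K ^ 4 - 4 * θ11F K ^ 3 - 3 * θ11F K ^ 2 + 3 * θ11F K + 1 = 0 := by
  apply (algebraMap (F5 K) K).injective
  simp only [map_add, map_sub, map_mul, map_pow, map_ofNat, map_one, map_zero]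
  exact θ11_rel K

/-! ### The conductor-`11` case of the six quintic descents -/

set_option backward.isDefEq.respectTransparency false in
/-- **The norm-`1` `2`-descent of `480a1` over the quintic subfields `F₅^{⟨σ⟩} ∋ θ11`**: if `σ ≠ 1`
fixes `θ11` then `F₅^{⟨σ⟩}` is a quintic field (`F5.finrank_fixedField_zpowers`) containing the root
`θ11` of `f = X⁵ + X⁴ - 4X³ - 3X² + 3X + 1` (a copy of `ℚ(ζ₁₁)⁺`), so for `(x, y) ∈ E(F₅^{⟨σ⟩})`,
`x ≠ 0, -2, 3`, with `N(x)`, `N(x + 2)` rational squares, `x` and `x + 2` are squares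
(`Literature.NumberTheory.NumberFields.CyclicQuintic11.normDescent_of_root`).
[cite: DokchitserDokchitser2011RankModN, proof of Thm. 2] -/
theorem F5.normDescent_fixedField_of_apply_θ11F_eq {σ : Gal((F5 K)/ℚ)} (hσ : σ ≠ 1)
    (hfix : σ (θ11F K) = θ11F K) :
    ∀ x y : fixedField (Subgroup.zpowers σ),
      (curve480a1.baseChange (fixedField (Subgroup.zpowers σ))).toAffine.Nonsingular x y →
      x ≠ 0 → x ≠ -2 → x ≠ 3 → IsSquare (Algebra.norm ℚ x) → IsSquare (Algebra.norm ℚ (x + 2)) →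
      IsSquare x ∧ IsSquare (x + 2) := by
  intro x y hxy h0 h2 h3 hN hN2
  set θ' : fixedField (Subgroup.zpowers σ) := ⟨θ11F K, F5.mem_fixedField_zpowers_of_apply_eq K hfix⟩
    with hθ'
  have hθ'rel : θ' ^ 5 + θ' ^ 4 - 4 * θ' ^ 3 - 3 * θ' ^ 2 + 3 * θ' + 1 = 0 := by
    apply (algebraMap (fixedField (Subgroup.zpowers σ)) (F5 K)).injective
    simp only [map_add, map_sub, map_mul, map_pow, map_ofNat, map_one, map_zero]
    exact θ11F_rel K
  have hpt := curve480a1.eq_and_ne_of_nonsingular (fixedField (Subgroup.zpowers σ)) hxy h0 h2 h3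
  exact Literature.NumberTheory.NumberFields.CyclicQuintic11.normDescent_of_root
    (F5.finrank_fixedField_zpowers K hσ) hθ'rel hpt.1 hpt.2 hN hN2

/-- **Five of the six quintic descents suffice (with the conductor-`11` one proved).** If the norm-`1`
descent statement holds over `F₅^{⟨σ⟩}` for every `σ ≠ 1` that does NOT fix `θ11`, then it holds for
every `σ ≠ 1`. [cite: DokchitserDokchitser2011RankModN, proof of Thm. 2] -/
theorem F5.normDescent_quintic_of_off11
    (h : ∀ σ : Gal((F5 K)/ℚ), σ ≠ 1 → σ (θ11F K) ≠ θ11F K → ∀ x y : fixedField (Subgroup.zpowers σ),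
      (curve480a1.baseChange (fixedField (Subgroup.zpowers σ))).toAffine.Nonsingular x y →
      x ≠ 0 → x ≠ -2 → x ≠ 3 → IsSquare (Algebra.norm ℚ x) → IsSquare (Algebra.norm ℚ (x + 2)) →
      IsSquare x ∧ IsSquare (x + 2)) :
    ∀ σ : Gal((F5 K)/ℚ), σ ≠ 1 → ∀ x y : fixedField (Subgroup.zpowers σ),
      (curve480a1.baseChange (fixedField (Subgroup.zpowers σ))).toAffine.Nonsingular x y →
      x ≠ 0 → x ≠ -2 → x ≠ 3 → IsSquare (Algebra.norm ℚ x) → IsSquare (Algebra.norm ℚ (x + 2)) →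
      IsSquare x ∧ IsSquare (x + 2) := by
  intro σ hσ
  by_cases hfix : σ (θ11F K) = θ11F K
  · exact F5.normDescent_fixedField_of_apply_θ11F_eq K hσ hfix
  · exact h σ hσ hfix

end DokchitserDokchitser2011

open DokchitserDokchitser2011

set_option backward.isDefEq.respectTransparency false in
/-- **What remains of the rank leaf after the conductor-`11` descent.** The tree's named fact
`DokchitserDokchitser2011_mordellWeilRank_480a1_F5` (`rk_ℤ E(F₅) = 1`, `E = 480a1`,
`F₅ = F5 (CyclotomicField 2651 ℚ)`) follows from the norm-`1` `2`-descent statements of `480a1` over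
the quintic subfields `F₅^{⟨σ⟩}` for the `σ ≠ 1` MOVING `θ11 = ζ₁₁ + ζ₁₁⁻¹` — i.e. over the quintic
subfields other than `ℚ(ζ₁₁)⁺` (conductor `241` and four of conductor `2651`); the conductor-`11`
subfield is settled by `CyclicQuintic11.normDescent_of_root`.
[cite: DokchitserDokchitser2011RankModN, proof of Thm. 2] -/
theorem DokchitserDokchitser2011_mordellWeilRank_480a1_F5_of_normDescent_off11
    (h : ∀ σ : Gal((F5 (CyclotomicField 2651 ℚ))/ℚ), σ ≠ 1 →
      σ (θ11F (CyclotomicField 2651 ℚ)) ≠ θ11F (CyclotomicField 2651 ℚ) →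
      ∀ x y : fixedField (Subgroup.zpowers σ),
      (curve480a1.baseChange (fixedField (Subgroup.zpowers σ))).toAffine.Nonsingular x y →
      x ≠ 0 → x ≠ -2 → x ≠ 3 → IsSquare (Algebra.norm ℚ x) → IsSquare (Algebra.norm ℚ (x + 2)) →
      IsSquare x ∧ IsSquare (x + 2)) :
    DokchitserDokchitser2011_mordellWeilRank_480a1_F5 :=
  DokchitserDokchitser2011_mordellWeilRank_480a1_F5_of_quintic_normDescent
    (F5.normDescent_quintic_of_off11 (CyclotomicField 2651 ℚ) h)

set_option backward.isDefEq.respectTransparency false in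
/-- **What remains of the `n = 5` fact after the conductor-`11` descent**: the named fact
`DokchitserDokchitser2011_rank_480a1_F5` (the field `F₅`, its splitting, `rk E(F₅) = 1`) follows from
the norm-`1` descent statements over the quintic subfields `F₅^{⟨σ⟩}`, `σ ≠ 1`, `σ θ11 ≠ θ11`
(conductors `241`, `2651`). [cite: DokchitserDokchitser2011RankModN, proof of Thm. 2] -/
theorem DokchitserDokchitser2011_rank_480a1_F5_of_normDescent_off11
    (h : ∀ σ : Gal((F5 (CyclotomicField 2651 ℚ))/ℚ), σ ≠ 1 →
      σ (θ11F (CyclotomicField 2651 ℚ)) ≠ θ11F (CyclotomicField 2651 ℚ) →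
      ∀ x y : fixedField (Subgroup.zpowers σ),
      (curve480a1.baseChange (fixedField (Subgroup.zpowers σ))).toAffine.Nonsingular x y →
      x ≠ 0 → x ≠ -2 → x ≠ 3 → IsSquare (Algebra.norm ℚ x) → IsSquare (Algebra.norm ℚ (x + 2)) →
      IsSquare x ∧ IsSquare (x + 2)) :
    DokchitserDokchitser2011_rank_480a1_F5 :=
  DokchitserDokchitser2011_rank_480a1_F5_of_quintic_normDescent
    (F5.normDescent_quintic_of_off11 (CyclotomicField 2651 ℚ) h)

end Literature.Barriers.BirchSwinnertonDyer

end
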